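import Literature.NumberTheory.EllipticCurves.SilvermanHeightLogDiscriminant
import Literature.NumberTheory.EllipticCurves.LatticeJInvariant
import Literature.NumberTheory.EllipticCurves.ComplexPeriod
import Mathlib.NumberTheory.Modular
import Mathlib.NumberTheory.ModularForms.Petersson
import Mathlib.Analysis.Real.Pi.Bounds
import Mathlib.Analysis.Complex.ExponentialBounds
import HarnessLib

/-!
# Proof of Pasten 2024 / Silverman 1986: `log |Δ_min| ≤ 12 h_F(E) + 16`

Topic `Literature/NumberTheory/EllipticCurves`; sibling PROOFS file of
`SilvermanHeightLogDiscriminant.lean`, discharging its named fact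
`pasten2024_log_minimalDiscriminant_le` (D-0014: `theorem …_holds : …`), with no new definitions
and no new named facts.

**Source.** H. Pasten, *Shimura curves and the abc conjecture*, J. Number Theory 254 (2024)
214–335 = arXiv:1705.09251 (held, read): §3, display `log Δ_E ≤ 12 h(E) + 16` ("by a formula of
Silverman"), and §18.1: Silverman's formula (EqSilvermanH)
`h(E) = (1/(12[L:ℚ]))(log Δ_E − Σ_σ log|Δ(τ_{E,σ}) · Im(τ_{E,σ})⁶|) − log(2π)` with
`Δ(z) = q ∏_{n ≥ 1} (1 − qⁿ)²⁴`, `q = e^{2πiz}`, from which "one deduces" **Lemma 18.1**: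
`(1/[L:ℚ]) log Δ_E < 12 h(E) + 16`. For `L = ℚ` the deduction is the inequality
`log(|Δ(τ)| Im(τ)⁶) + 12 log(2π) < 16` for `τ ∈ ℍ`, i.e. the classical boundedness of the
`SL₂(ℤ)`-invariant function `|Δ(τ)| Im(τ)⁶` (J. H. Silverman, *Heights and elliptic curves*, 1986,
Prop. 1.1 and Remark 1.2), made explicit. That is what this file proves.

**The argument formalised here** (in the tree's dictionary `h(E) = −½ log covol(Λ_Néron)`,
`neronLatticeHeight`, so that `log|Δ_W| − 12 h = log(|g₂³ − 27g₃²|(Λ) · covol(Λ)⁶)`):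
1. `Δ = η²⁴ = q ∏(1 − qⁿ)²⁴` (Mathlib `ModularForm.discriminant`) gives
   `|Δ(τ)| ≤ e^{−2πy} exp(24 r/(1 − r))`, `r = e^{−2πy}`, `y = Im τ`
   (`norm_discriminant_le_exp_mul_exp`; `|1 − qⁿ| ≤ 1 + rⁿ ≤ e^{rⁿ}`).
2. Numerics on `3 ≤ 4y²` (the standard fundamental domain): `y⁶e^{−2πy} ≤ (3/π)⁶e⁻⁶`
   (`t ≤ e^{t−1}`), `r ≤ e^{−5.4} ≤ 1/200`, so
   `(2π)¹² |Δ(τ)| y⁶ ≤ 2¹²3⁶π⁶ e^{24/199} e⁻⁶ ≤ e¹⁶` (`two_pi_pow_twelve_mul_le_exp_sixteen`;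
   numerically the left side is `≈ e^{15.90}`, the true supremum being `≈ e^{15.85}` at `τ = ρ`).
3. `|Δ(γτ)| Im(γτ)⁶ = |Δ(τ)| Im(τ)⁶` for `γ ∈ SL₂(ℤ)` (Mathlib: Petersson norm of the weight-12
   cusp form `Δ`, `SlashInvariantFormClass.norm_petersson_smul`) and every `τ` has a translate in
   the fundamental domain (`ModularGroup.exists_smul_mem_fd`), so `(2π)¹²|Δ(τ)|Im(τ)⁶ ≤ e¹⁶` on `ℍ`.
4. Every lattice is `cΛ_τ` (tree: `PeriodPair.exists_lattice_eq_mulLeft_ofUpperHalfPlane`),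
   `g₂³ − 27g₃²` scales by `c⁻¹²` (`discr_mulLeft`) and equals `(2π)¹²Δ(τ)` on `Λ_τ`
   (`discr_ofUpperHalfPlane`, i.e. Mathlib's `Δ = (E₄³ − E₆²)/1728` with `g₂ = (4π⁴/3)E₄`,
   `g₃ = (8π⁶/27)E₆`), `covol(cΛ_τ) = |c|² Im τ` (`covolume_mulLeft_lattice`,
   `covolume_ofUpperHalfPlane_lattice`); hence `|g₂³ − 27g₃²| · covol⁶ ≤ e¹⁶` for EVERY lattice
   (`norm_discr_mul_covolume_pow_six_le`).
5. For a Néron lattice of `W/ℚ`, `g₂³ − 27g₃² = (c₄³ − c₆²)/1728 = Δ_W`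
   (`discr_eq_ratCast_Δ_of_isNeronLatticeOf`); taking logarithms gives the fact
   (`pasten2024_log_minimalDiscriminant_le_holds`). Minimality of `W` is not used by the
   inequality itself (it only identifies `Δ_W` with the minimal discriminant).

## References

* H. Pasten, *Shimura curves and the abc conjecture*, J. Number Theory 254 (2024) 214–335,
  arXiv:1705.09251: §3 (display `log Δ_E ≤ 12h(E) + 16`), §18.1 (EqSilvermanH), Lemma 18.1.
  [`PastenShimura2024`]
* J. H. Silverman, *Heights and elliptic curves*, in Arithmetic Geometry (Cornell–Silverman eds.),
  Springer (1986) 253–265: Prop. 1.1, Remark 1.2. [`Silverman1986`]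
-/

noncomputable section

namespace Literature.NumberTheory.EllipticCurves.ModularForms

open Complex UpperHalfPlane
open scoped Real MatrixGroups Modular

/-! ### Step 1: the `η`-product bound for `Δ(τ)` -/

/-- Finite pieces of the product bound: for `‖q‖ = r < 1` and any finite set of indices,
`∏ ‖1 - q^{n+1}‖ ≤ ∏ (1 + r^{n+1}) ≤ exp(∑ r^{n+1}) ≤ exp(r/(1 - r))`. [folklore] -/
theorem prod_norm_one_sub_pow_le_exp {q : ℂ} (hq : ‖q‖ < 1) (s : Finset ℕ) :
    ∏ i ∈ s, ‖1 - q ^ (i + 1)‖ ≤ Real.exp (‖q‖ / (1 - ‖q‖)) := by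
  set r : ℝ := ‖q‖ with hr
  have hr0 : 0 ≤ r := norm_nonneg q
  have hgeom : HasSum (fun i : ℕ ↦ r ^ (i + 1)) (r / (1 - r)) := by
    have h := (hasSum_geometric_of_lt_one hr0 hq).mul_left r
    simp_rw [← pow_succ'] at h
    rwa [div_eq_mul_inv]
  calc ∏ i ∈ s, ‖1 - q ^ (i + 1)‖ ≤ ∏ i ∈ s, Real.exp (r ^ (i + 1)) := by
        refine Finset.prod_le_prod (fun i _ ↦ norm_nonneg _) fun i _ ↦ ?_
        calc ‖1 - q ^ (i + 1)‖ ≤ ‖(1 : ℂ)‖ + ‖q ^ (i + 1)‖ := norm_sub_le _ _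
          _ = r ^ (i + 1) + 1 := by rw [norm_one, norm_pow, add_comm]
          _ ≤ Real.exp (r ^ (i + 1)) := Real.add_one_le_exp _
    _ = Real.exp (∑ i ∈ s, r ^ (i + 1)) := (Real.exp_sum s _).symm
    _ ≤ Real.exp (r / (1 - r)) := by
        refine Real.exp_le_exp.mpr ?_
        exact sum_le_hasSum s (fun i _ ↦ pow_nonneg hr0 _) hgeom

/-- `‖∏' (1 - q^{n+1})‖ ≤ exp(‖q‖/(1 - ‖q‖))` for `‖q‖ < 1` (the Euler-product factor of `η`).
[folklore] -/
theorem norm_tprod_one_sub_pow_le_exp {q : ℂ} (hq : ‖q‖ < 1) :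
    ‖∏' n : ℕ, (1 - q ^ (n + 1))‖ ≤ Real.exp (‖q‖ / (1 - ‖q‖)) := by
  rw [(ModularForm.multipliable_one_sub_pow hq).norm_tprod]
  exact tprod_le_of_prod_le' (Real.one_le_exp (div_nonneg (norm_nonneg q)
    (sub_nonneg.mpr hq.le))) (prod_norm_one_sub_pow_le_exp hq)

/-- The size of `q = e^{2πiτ}`: `‖q‖ = e^{-2π Im τ}`. [folklore] -/
theorem norm_qParam_one_eq_exp (z : ℍ) :
    ‖Function.Periodic.qParam 1 (z : ℂ)‖ = Real.exp (-(2 * π * z.im)) := by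
  rw [Function.Periodic.norm_qParam]
  congr 1
  rw [div_one, UpperHalfPlane.coe_im]
  ring

/-- **`|Δ(τ)| ≤ e^{-2πy} · exp(24r/(1 - r))`**, `r = e^{-2πy}`, `y = Im τ`: from Mathlib's
`Δ = η²⁴`, `η = q^{1/24} ∏ (1 - qⁿ)` (`ModularForm.discriminant`, `ModularForm.eta`) and
`|1 - qⁿ| ≤ 1 + rⁿ ≤ exp(rⁿ)`. [folklore] -/
theorem norm_discriminant_le_exp_mul_exp (z : ℍ) :
    ‖ModularForm.discriminant z‖ ≤
      Real.exp (-(2 * π * z.im)) *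
        Real.exp (24 * (Real.exp (-(2 * π * z.im)) / (1 - Real.exp (-(2 * π * z.im))))) := by
  have hq : ‖Function.Periodic.qParam 1 (z : ℂ)‖ < 1 := by
    simpa using UpperHalfPlane.norm_qParam_lt_one 1 z
  have h24 : ‖Function.Periodic.qParam 24 (z : ℂ)‖ ^ 24 = Real.exp (-(2 * π * z.im)) := by
    rw [Function.Periodic.norm_qParam, ← Real.exp_nat_mul]
    congr 1
    rw [UpperHalfPlane.coe_im]
    push_cast
    ring
  have hprod := norm_tprod_one_sub_pow_le_exp hq
  rw [norm_qParam_one_eq_exp] at hprod hq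
  rw [ModularForm.discriminant, norm_pow, ModularForm.eta, norm_mul, mul_pow, h24]
  refine mul_le_mul_of_nonneg_left ?_ (Real.exp_nonneg _)
  rw [mul_comm (24 : ℝ), Real.exp_mul, show ((24 : ℝ)) = ((24 : ℕ) : ℝ) by norm_num,
    Real.rpow_natCast]
  exact pow_le_pow_left₀ (norm_nonneg _) hprod 24

/-! ### Step 2: numerics on the fundamental domain -/

/-- `y⁶ e^{-2πy} ≤ (3/π)⁶ e⁻⁶` for `y ≥ 0` (from `t ≤ e^{t-1}`, `t = πy/3`). [folklore] -/
theorem pow_six_mul_exp_neg_two_pi_mul_le {y : ℝ} (hy : 0 ≤ y) :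
    y ^ 6 * Real.exp (-(2 * π * y)) ≤ (3 / π) ^ 6 * Real.exp (-6) := by
  have hπ := Real.pi_pos
  set t := π * y / 3 with ht
  have ht0 : 0 ≤ t := by positivity
  have h1 : t ≤ Real.exp (t - 1) := by have := Real.add_one_le_exp (t - 1); linarith
  have h2 : t ^ 6 ≤ Real.exp (t - 1) ^ 6 := pow_le_pow_left₀ ht0 h1 6
  rw [← Real.exp_nat_mul] at h2
  have hy' : y = 3 / π * t := by rw [ht]; field_simp
  rw [hy', mul_pow]
  have h3 : -(2 * π * (3 / π * t)) = -(6 * t) := by field_simp; ring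
  rw [h3, mul_assoc]
  refine mul_le_mul_of_nonneg_left ?_ (by positivity)
  calc t ^ 6 * Real.exp (-(6 * t)) ≤ Real.exp ((6 : ℕ) * (t - 1)) * Real.exp (-(6 * t)) :=
        mul_le_mul_of_nonneg_right h2 (Real.exp_nonneg _)
    _ = Real.exp (-6) := by rw [← Real.exp_add]; congr 1; push_cast; ring

/-- On `3 ≤ 4y²` (e.g. `Im τ` for `τ` in the standard fundamental domain): `e^{-2πy} ≤ 1/200`.
[folklore] -/
theorem exp_neg_two_pi_mul_le_inv_two_hundred {y : ℝ} (hy0 : 0 < y) (hy : 3 ≤ 4 * y ^ 2) :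
    Real.exp (-(2 * π * y)) ≤ 1 / 200 := by
  have hπ := Real.pi_gt_d2
  have hu : (5.4 : ℝ) ≤ 2 * π * y := by nlinarith
  have he : (200 : ℝ) ≤ Real.exp (2 * π * y) := by
    calc (200 : ℝ) ≤ 2.7182818283 ^ 5 * (1 + 0.4 + 0.4 ^ 2 / 2) := by norm_num
      _ ≤ Real.exp 1 ^ 5 * Real.exp 0.4 :=
          mul_le_mul (pow_le_pow_left₀ (by norm_num) Real.exp_one_gt_d9.le 5)
            (Real.quadratic_le_exp_of_nonneg (by norm_num)) (by norm_num) (by positivity)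
      _ = Real.exp 5.4 := by rw [← Real.exp_nat_mul, ← Real.exp_add]; norm_num
      _ ≤ Real.exp (2 * π * y) := Real.exp_le_exp.mpr hu
  rw [Real.exp_neg, ← one_div]
  exact one_div_le_one_div_of_le (by norm_num) he

/-- **The numerical inequality**: for `3 ≤ 4y²`, `y > 0`,
`(2π)¹² · e^{-2πy} · exp(24r/(1-r)) · y⁶ ≤ e¹⁶` with `r = e^{-2πy}`
(`≤ 2¹²3⁶π⁶e⁻⁶ · e^{24/199} ≈ e^{15.90}`). [folklore] -/
theorem two_pi_pow_twelve_mul_le_exp_sixteen {y : ℝ} (hy0 : 0 < y) (hy : 3 ≤ 4 * y ^ 2) :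
    (2 * π) ^ 12 * (Real.exp (-(2 * π * y)) *
      Real.exp (24 * (Real.exp (-(2 * π * y)) / (1 - Real.exp (-(2 * π * y)))))) * y ^ 6 ≤
      Real.exp 16 := by
  set r := Real.exp (-(2 * π * y)) with hr
  have hr0 : 0 < r := Real.exp_pos _
  have hr1 : r ≤ 1 / 200 := exp_neg_two_pi_mul_le_inv_two_hundred hy0 hy
  have h1r : 0 < 1 - r := by linarith
  set s := 24 * (r / (1 - r)) with hs
  have hs0 : 0 ≤ s := by positivity
  have hs1 : s ≤ 24 / 199 := by
    have : r / (1 - r) ≤ 1 / 199 := by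
      rw [div_le_div_iff₀ h1r (by norm_num)]
      linarith
    linarith
  have hexp_s : Real.exp s ≤ 1 + 24 / 199 + (24 / 199) ^ 2 := by
    have h := Real.abs_exp_sub_one_sub_id_le (x := s) (by rw [abs_of_nonneg hs0]; linarith)
    have h' := (abs_le.mp h).2
    nlinarith [hs0, hs1]
  have hmain := pow_six_mul_exp_neg_two_pi_mul_le hy0.le
  have hπ := Real.pi_lt_d4
  have hπ0 := Real.pi_pos
  have he := Real.exp_one_gt_d9
  calc (2 * π) ^ 12 * (r * Real.exp s) * y ^ 6
        = (2 * π) ^ 12 * Real.exp s * (y ^ 6 * r) := by ring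
    _ ≤ (2 * π) ^ 12 * (1 + 24 / 199 + (24 / 199) ^ 2) * ((3 / π) ^ 6 * Real.exp (-6)) := by
        gcongr
    _ = 2985984 * π ^ 6 * (1 + 24 / 199 + (24 / 199) ^ 2) * Real.exp (-6) := by
        field_simp
        ring
    _ ≤ 2985984 * 3.1416 ^ 6 * (1 + 24 / 199 + (24 / 199) ^ 2) * Real.exp (-6) := by gcongr
    _ ≤ 2.7182818283 ^ 22 * Real.exp (-6) :=
        mul_le_mul_of_nonneg_right (by norm_num) (Real.exp_nonneg _)
    _ ≤ Real.exp 1 ^ 22 * Real.exp (-6) := by gcongr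
    _ = Real.exp 16 := by rw [← Real.exp_nat_mul, ← Real.exp_add]; norm_num

/-! ### Step 3: `F(τ) = (2π)¹² |Δ(τ)| (Im τ)⁶` is `SL₂(ℤ)`-invariant and `≤ e¹⁶` on `ℍ` -/

/-- `|Δ(γτ)| · Im(γτ)⁶ = |Δ(τ)| · Im(τ)⁶` for `γ ∈ SL₂(ℤ)`: the Petersson norm of the weight-`12`
cusp form `Δ` (Mathlib `SlashInvariantFormClass.norm_petersson_smul`). [folklore] -/
theorem norm_discriminant_mul_im_pow_six_smul (γ : SL(2, ℤ)) (τ : ℍ) :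
    ‖ModularForm.discriminant (γ • τ)‖ * (γ • τ).im ^ 6 =
      ‖ModularForm.discriminant τ‖ * τ.im ^ 6 := by
  have hγ : (γ : GL (Fin 2) ℝ) ∈ 𝒮ℒ := ⟨γ, rfl⟩
  have key : ∀ σ : ℍ,
      ‖UpperHalfPlane.petersson 12 CuspForm.discriminant CuspForm.discriminant σ‖ =
        (‖ModularForm.discriminant σ‖ * σ.im ^ 6) ^ 2 := by
    intro σ
    simp only [UpperHalfPlane.petersson, norm_mul, Complex.norm_conj, norm_zpow,
      Complex.norm_real, Real.norm_eq_abs, abs_of_pos σ.im_pos, CuspForm.coe_discriminant]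
    norm_cast
    ring
  have h := SlashInvariantFormClass.norm_petersson_smul (k := 12) (τ := τ)
    (f := CuspForm.discriminant) (f' := CuspForm.discriminant) hγ
  rw [key, key] at h
  exact (pow_left_inj₀ (by positivity) (by positivity) two_ne_zero).mp h

/-- **`(2π)¹² |Δ(τ)| (Im τ)⁶ ≤ e¹⁶` on all of `ℍ`**: move `τ` into the standard fundamental domain
(`ModularGroup.exists_smul_mem_fd`, invariance above), where `Im τ ≥ √3/2`, and apply the
`η`-product bound and the numerics. This is the bound `log|Δ(τ)Im(τ)⁶| + 12 log(2π) < 16` behind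
Pasten's Lemma 18.1. [cite: PastenShimura2024, §18.1 Lemma 18.1] -/
theorem two_pi_pow_mul_norm_discriminant_mul_im_pow_six_le (τ : ℍ) :
    (2 * π) ^ 12 * ‖ModularForm.discriminant τ‖ * τ.im ^ 6 ≤ Real.exp 16 := by
  obtain ⟨γ, hγ⟩ := ModularGroup.exists_smul_mem_fd τ
  rw [mul_assoc, ← norm_discriminant_mul_im_pow_six_smul γ τ, ← mul_assoc]
  have him : 3 ≤ 4 * (γ • τ).im ^ 2 := ModularGroup.three_le_four_mul_im_sq_of_mem_fd hγ
  calc (2 * π) ^ 12 * ‖ModularForm.discriminant (γ • τ)‖ * (γ • τ).im ^ 6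
      ≤ (2 * π) ^ 12 * (Real.exp (-(2 * π * (γ • τ).im)) *
          Real.exp (24 * (Real.exp (-(2 * π * (γ • τ).im)) /
            (1 - Real.exp (-(2 * π * (γ • τ).im)))))) * (γ • τ).im ^ 6 := by
        gcongr
        exact norm_discriminant_le_exp_mul_exp _
    _ ≤ Real.exp 16 := two_pi_pow_twelve_mul_le_exp_sixteen (γ • τ).im_pos him

/-! ### Step 4: lattices — `|g₂³ − 27g₃²| · covol⁶ ≤ e¹⁶` -/

open PeriodPair _root_.MeasureTheory in
/-- `covol(Λ_τ) = Im τ` for `Λ_τ = ℤτ + ℤ` (area of the parallelogram on `τ, 1`). [folklore] -/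
theorem covolume_ofUpperHalfPlane_lattice (τ : ℍ) :
    ZLattice.covolume (ofUpperHalfPlane τ).lattice = τ.im := by
  rw [ZLattice.covolume_eq_det_mul_measureReal (ofUpperHalfPlane τ).lattice volume
      (ofUpperHalfPlane τ).latticeBasis Complex.basisOneI]
  have hvol : (volume : Measure ℂ).real (ZSpan.fundamentalDomain Complex.basisOneI) = 1 := by
    rw [measureReal_congr (ZSpan.fundamentalDomain_ae_parallelepiped Complex.basisOneI volume),
      measureReal_def, Complex.coe_basisOneI, ← Complex.coe_orthonormalBasisOneI,
      Complex.orthonormalBasisOneI.volume_parallelepiped, ENNReal.toReal_one]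
  have h1 : ((↑) : (ofUpperHalfPlane τ).lattice → ℂ) ∘ (ofUpperHalfPlane τ).latticeBasis =
      (ofUpperHalfPlane τ).basis := by
    ext i
    fin_cases i <;> simp
  rw [hvol, mul_one, h1, Module.Basis.det_apply, Matrix.det_fin_two]
  simp [Module.Basis.toMatrix_apply, Complex.coe_basisOneI_repr, abs_of_pos τ.im_pos]

open PeriodPair in
/-- **`|Δ(Λ)| · covol(Λ)⁶ ≤ e¹⁶` for every lattice `Λ ⊂ ℂ`**, `Δ(Λ) = g₂(Λ)³ − 27g₃(Λ)²`:
`Λ = cΛ_τ` (`exists_lattice_eq_mulLeft_ofUpperHalfPlane`), `Δ(cΛ_τ) = c⁻¹²(2π)¹²Δ(τ)`,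
`covol(cΛ_τ) = |c|² Im τ`, so the product is `(2π)¹²|Δ(τ)|(Im τ)⁶ ≤ e¹⁶`. [folklore] -/
theorem norm_discr_mul_covolume_pow_six_le (L : PeriodPair) :
    ‖L.g₂ ^ 3 - 27 * L.g₃ ^ 2‖ * ZLattice.covolume L.lattice ^ 6 ≤ Real.exp 16 := by
  obtain ⟨τ, c, hc, h⟩ := L.exists_lattice_eq_mulLeft_ofUpperHalfPlane
  rw [g₂_eq_of_lattice_eq h, g₃_eq_of_lattice_eq h, discr_mulLeft, discr_ofUpperHalfPlane]
  have hcov : ZLattice.covolume L.lattice = ‖c‖ ^ 2 * τ.im := by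
    rw [← covolume_ofUpperHalfPlane_lattice τ, ← covolume_mulLeft_lattice _ c hc]
    simp only [h]
  have hc' : ‖c‖ ≠ 0 := norm_ne_zero_iff.mpr hc
  rw [hcov, norm_mul, norm_inv, norm_pow, norm_mul, norm_pow, norm_mul, Complex.norm_real,
    Real.norm_of_nonneg Real.pi_pos.le, Complex.norm_ofNat]
  calc (‖c‖ ^ 12)⁻¹ * ((2 * π) ^ 12 * ‖ModularForm.discriminant τ‖) * (‖c‖ ^ 2 * τ.im) ^ 6
      = (2 * π) ^ 12 * ‖ModularForm.discriminant τ‖ * τ.im ^ 6 := by field_simp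
    _ ≤ Real.exp 16 := two_pi_pow_mul_norm_discriminant_mul_im_pow_six_le τ

/-! ### Step 5: the dictionary `Δ_W = g₂³ − 27g₃²` and the discharge -/

open WeierstrassCurve in
/-- For a Néron lattice `L` of `W/ℚ` (`g₂ = c₄/12`, `g₃ = c₆/216`): `g₂³ − 27g₃² = Δ_W`
(`1728Δ = c₄³ − c₆²`, Mathlib `WeierstrassCurve.c_relation`). [folklore] -/
theorem discr_eq_ratCast_Δ_of_isNeronLatticeOf {W : WeierstrassCurve ℚ} {L : PeriodPair}
    (hL : IsNeronLatticeOf (W.baseChange ℂ) L) :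
    L.g₂ ^ 3 - 27 * L.g₃ ^ 2 = ((W.Δ : ℚ) : ℂ) := by
  rw [hL.1, hL.2]
  have h := (W.baseChange ℂ).c_relation
  simp only [WeierstrassCurve.baseChange, map_c₄, map_c₆, map_Δ, eq_ratCast] at h ⊢
  linear_combination (1 / 1728 : ℂ) * h.symm

/-- **Discharge of `pasten2024_log_minimalDiscriminant_le`**: `log|Δ_W| ≤ 12 h + 16` with
`h = −½ log covol(Λ_Néron)`, i.e. `|Δ_W| · covol⁶ ≤ e¹⁶`, from
`norm_discr_mul_covolume_pow_six_le` and the dictionary. Pasten deduces it ("one deduces",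
§18.1) from Silverman's formula `h(E) = (1/12)(log Δ_E − log|Δ(τ)Im(τ)⁶|) − log(2π)`; the
deduction is the classical bound of `|Δ(τ)|Im(τ)⁶` on the fundamental domain carried out above.
[cite: PastenShimura2024, §3 (display log Δ_E ≤ 12h(E)+16) and §18.1 Lemma 18.1] -/
theorem pasten2024_log_minimalDiscriminant_le_holds : pasten2024_log_minimalDiscriminant_le := by
  intro W _ _ L hL
  have hcov : 0 < ZLattice.covolume L.lattice := ZLattice.covolume_pos L.lattice _
  have hΔ : 0 < |((W.Δ : ℚ) : ℝ)| := lt_of_lt_of_le one_pos (one_le_abs_Δ W)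
  have key := norm_discr_mul_covolume_pow_six_le L
  rw [discr_eq_ratCast_Δ_of_isNeronLatticeOf hL, ← Complex.ofReal_ratCast, Complex.norm_real,
    Real.norm_eq_abs] at key
  have h2 : Real.log (|((W.Δ : ℚ) : ℝ)| * ZLattice.covolume L.lattice ^ 6) ≤ 16 :=
    (Real.log_le_iff_le_exp (mul_pos hΔ (pow_pos hcov 6))).2 key
  rw [Real.log_mul hΔ.ne' (pow_ne_zero 6 hcov.ne'), Real.log_pow] at h2
  rw [twelve_mul_neronLatticeHeight]
  push_cast at h2
  linarith

end Literature.NumberTheory.EllipticCurves.ModularForms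

end
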